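import Literature.NumberTheory.EllipticCurves.GreenbergVatsal2000.CharacterLambdaCertificateProofs
import HarnessLib

/-!
# Greenberg–Vatsal 2000 §3 (26)/(27): the `λ = 2` CERTIFICATE — `ord_T(L_{Σ₀}(C ⊗ χ, T) mod p) = 2`
# (resp. for `D`) from THREE interpolation values (THEOREMS)

HONEST FRAMING (cell `bsd-eis`, seat `bsd-eis-x3` gen 4; FULL-BSD rank-`≤ 1` programme D-0033): theorems
only, no named fact; nothing booked. The `a = 2` instance of the divided-difference kernel
`order_toNat_eq_of_isCharacterLFunctionC/D_of_lagrange` (`CharacterLambdaCertificateProofs.lean`;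
Greenberg 2001 §4 p. 356), with the three Lagrange divided differences at the nodes
`x_i = κ(γ)^{±i} − 1` written out: `L₀ = V₁`, `L₁ = (V₂ − V₁)/x₁`,
`L₂ = V₁/(x₁x₂) + V₂/(x₁(x₁ − x₂)) + V₃/(x₂(x₂ − x₁))`; `‖L₀‖, ‖L₁‖ < 1 ≤ ‖L₂‖` certifies `ord_T = 2`.
Companion of `CharacterLambdaCertificateOneProofs.lean` (the `a = 1` instance), for the X3
certificate-road displays whose `Σ₀`-imprimitive order is `2`.

* `order_toNat_eq_two_of_isCharacterLFunctionC`, `order_toNat_eq_two_of_isCharacterLFunctionD`.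

References: [GreenbergVatsal2000] §3 pp. 41–42 ((26), (27)); [Greenberg2001PastPresent] §4 pp. 355–356.
-/

noncomputable section

open scoped Classical

open Finset NumberField IsDedekindDomain Literature.NumberTheory.EllipticCurves

namespace Literature.NumberTheory.EllipticCurves.GreenbergVatsal2000

variable (p : ℕ) [Fact p.Prime] {m d : ℕ} (φ : DirichletCharacter (ZMod p) m)
  (ψ : DirichletCharacter (ZMod p) d) (S₀ : Finset (HeightOneSpectrum (𝓞 ℚ)))

/-- `(range 2).erase 0 = {1}`. [folklore] -/
private theorem range_two_erase_zero' : (range 2).erase 0 = {1} := by decide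

/-- `(range 2).erase 1 = {0}`. [folklore] -/
private theorem range_two_erase_one' : (range 2).erase 1 = {0} := by decide

/-- `(range 3).erase 0 = {1, 2}`. [folklore] -/
private theorem range_three_erase_zero : (range 3).erase 0 = {1, 2} := by decide

/-- `(range 3).erase 1 = {0, 2}`. [folklore] -/
private theorem range_three_erase_one : (range 3).erase 1 = {0, 2} := by decide

/-- `(range 3).erase 2 = {0, 1}`. [folklore] -/
private theorem range_three_erase_two : (range 3).erase 2 = {0, 1} := by decide

/-- **`λ = 2` certificate for `L_{Σ₀}(C ⊗ χ, T)`**: with `V_k = characterLValueC p φ Σ₀ k` (GV (26) at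
`T = κ^{k−1} − 1`, `κ = κ(γ)`), if `‖V₁‖ < 1`, `‖(V₂ − V₁)/(κ − 1)‖ < 1` and
`‖V₁/((κ−1)(κ²−1)) + V₂/((κ−1)((κ−1) − (κ²−1))) + V₃/((κ²−1)((κ²−1) − (κ−1)))‖ ≥ 1` then
`ord_T(g mod p) = 2`. [cite: GreenbergVatsal2000, §3 p. 41 (26)] [cite: Greenberg2001PastPresent, §4 p. 356] -/
theorem order_toNat_eq_two_of_isCharacterLFunctionC {g : IwasawaAlgebra p}
    (hg : IsCharacterLFunctionC p φ S₀ g) (h0 : ‖characterLValueC p φ S₀ 1‖ < 1)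
    (h1 : ‖(characterLValueC p φ S₀ 2 - characterLValueC p φ S₀ 1) /
      (((cyclotomicGenerator p : ℕ) : ℚ_[p]) - 1)‖ < 1)
    (h2 : 1 ≤ ‖characterLValueC p φ S₀ 1 /
        ((((cyclotomicGenerator p : ℕ) : ℚ_[p]) - 1) * (((cyclotomicGenerator p : ℕ) : ℚ_[p]) ^ 2 - 1)) +
      characterLValueC p φ S₀ 2 /
        ((((cyclotomicGenerator p : ℕ) : ℚ_[p]) - 1) *
          ((((cyclotomicGenerator p : ℕ) : ℚ_[p]) - 1) - (((cyclotomicGenerator p : ℕ) : ℚ_[p]) ^ 2 - 1))) +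
      characterLValueC p φ S₀ 3 /
        ((((cyclotomicGenerator p : ℕ) : ℚ_[p]) ^ 2 - 1) *
          ((((cyclotomicGenerator p : ℕ) : ℚ_[p]) ^ 2 - 1) - (((cyclotomicGenerator p : ℕ) : ℚ_[p]) - 1)))‖) :
    (PowerSeries.map (PadicInt.toZMod (p := p)) g).order.toNat = 2 := by
  refine order_toNat_eq_of_isCharacterLFunctionC_of_lagrange p φ S₀ hg (a := 2) ?_ ?_
  · intro j hj
    rcases Nat.lt_succ_iff_lt_or_eq.mp hj with hj' | rfl
    · have hj0 : j = 0 := by omega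
      subst hj0
      simpa using h0
    · have hsum : ∑ i ∈ range (1 + 1), characterLValueC p φ S₀ (i + 1) /
          ∏ k ∈ (range (1 + 1)).erase i,
            ((((cyclotomicGenerator p : ℕ) : ℚ_[p]) ^ i - 1) -
              (((cyclotomicGenerator p : ℕ) : ℚ_[p]) ^ k - 1)) =
          (characterLValueC p φ S₀ 2 - characterLValueC p φ S₀ 1) /
            (((cyclotomicGenerator p : ℕ) : ℚ_[p]) - 1) := by
        rw [Finset.sum_range_succ, Finset.sum_range_one, show (1 + 1 : ℕ) = 2 from rfl,
          range_two_erase_zero', range_two_erase_one', Finset.prod_singleton, Finset.prod_singleton,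
          pow_zero, pow_one]
        simp only [sub_self, zero_sub, sub_zero, div_neg]
        ring
      rw [hsum]
      exact h1
  · have h01 : (0 : ℕ) ≠ 1 := by decide
    have h02 : (0 : ℕ) ≠ 2 := by decide
    have h12 : (1 : ℕ) ≠ 2 := by decide
    have hsum : ∑ i ∈ range (2 + 1), characterLValueC p φ S₀ (i + 1) /
        ∏ k ∈ (range (2 + 1)).erase i,
          ((((cyclotomicGenerator p : ℕ) : ℚ_[p]) ^ i - 1) -
            (((cyclotomicGenerator p : ℕ) : ℚ_[p]) ^ k - 1)) =
        characterLValueC p φ S₀ 1 /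
          ((((cyclotomicGenerator p : ℕ) : ℚ_[p]) - 1) * (((cyclotomicGenerator p : ℕ) : ℚ_[p]) ^ 2 - 1)) +
        characterLValueC p φ S₀ 2 /
          ((((cyclotomicGenerator p : ℕ) : ℚ_[p]) - 1) *
            ((((cyclotomicGenerator p : ℕ) : ℚ_[p]) - 1) - (((cyclotomicGenerator p : ℕ) : ℚ_[p]) ^ 2 - 1))) +
        characterLValueC p φ S₀ 3 /
          ((((cyclotomicGenerator p : ℕ) : ℚ_[p]) ^ 2 - 1) *
            ((((cyclotomicGenerator p : ℕ) : ℚ_[p]) ^ 2 - 1) - (((cyclotomicGenerator p : ℕ) : ℚ_[p]) - 1))) := by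
      rw [Finset.sum_range_succ, Finset.sum_range_succ, Finset.sum_range_one, show (2 + 1 : ℕ) = 3 from rfl,
        range_three_erase_zero, range_three_erase_one, range_three_erase_two,
        Finset.prod_pair h12, Finset.prod_pair h02, Finset.prod_pair h01, pow_zero, pow_one]
      simp only [sub_self, zero_sub, sub_zero, neg_mul_neg]
    rw [hsum]
    exact h2

/-- **`λ = 2` certificate for `L_{Σ₀}(D ⊗ χ, T)`** (GV (27), nodes `κ(γ)^{−i} − 1`): same shape with
`κ⁻¹` in place of `κ`. [cite: GreenbergVatsal2000, §3 p. 42 (27)] [cite: Greenberg2001PastPresent, §4 p. 356] -/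
theorem order_toNat_eq_two_of_isCharacterLFunctionD {g : IwasawaAlgebra p}
    (hg : IsCharacterLFunctionD p ψ S₀ g) (h0 : ‖characterLValueD p ψ S₀ 1‖ < 1)
    (h1 : ‖(characterLValueD p ψ S₀ 2 - characterLValueD p ψ S₀ 1) /
      ((((cyclotomicGenerator p : ℕ) : ℚ_[p])⁻¹) - 1)‖ < 1)
    (h2 : 1 ≤ ‖characterLValueD p ψ S₀ 1 /
        (((((cyclotomicGenerator p : ℕ) : ℚ_[p])⁻¹) - 1) * ((((cyclotomicGenerator p : ℕ) : ℚ_[p])⁻¹) ^ 2 - 1)) +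
      characterLValueD p ψ S₀ 2 /
        (((((cyclotomicGenerator p : ℕ) : ℚ_[p])⁻¹) - 1) *
          (((((cyclotomicGenerator p : ℕ) : ℚ_[p])⁻¹) - 1) - ((((cyclotomicGenerator p : ℕ) : ℚ_[p])⁻¹) ^ 2 - 1))) +
      characterLValueD p ψ S₀ 3 /
        (((((cyclotomicGenerator p : ℕ) : ℚ_[p])⁻¹) ^ 2 - 1) *
          (((((cyclotomicGenerator p : ℕ) : ℚ_[p])⁻¹) ^ 2 - 1) - ((((cyclotomicGenerator p : ℕ) : ℚ_[p])⁻¹) - 1)))‖) :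
    (PowerSeries.map (PadicInt.toZMod (p := p)) g).order.toNat = 2 := by
  refine order_toNat_eq_of_isCharacterLFunctionD_of_lagrange p ψ S₀ hg (a := 2) ?_ ?_
  · intro j hj
    rcases Nat.lt_succ_iff_lt_or_eq.mp hj with hj' | rfl
    · have hj0 : j = 0 := by omega
      subst hj0
      simpa using h0
    · have hsum : ∑ i ∈ range (1 + 1), characterLValueD p ψ S₀ (i + 1) /
          ∏ k ∈ (range (1 + 1)).erase i,
            (((((cyclotomicGenerator p : ℕ) : ℚ_[p])⁻¹) ^ i - 1) -
              ((((cyclotomicGenerator p : ℕ) : ℚ_[p])⁻¹) ^ k - 1)) =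
          (characterLValueD p ψ S₀ 2 - characterLValueD p ψ S₀ 1) /
            ((((cyclotomicGenerator p : ℕ) : ℚ_[p])⁻¹) - 1) := by
        rw [Finset.sum_range_succ, Finset.sum_range_one, show (1 + 1 : ℕ) = 2 from rfl,
          range_two_erase_zero', range_two_erase_one', Finset.prod_singleton, Finset.prod_singleton,
          pow_zero, pow_one]
        simp only [sub_self, zero_sub, sub_zero, div_neg]
        ring
      rw [hsum]
      exact h1
  · have h01 : (0 : ℕ) ≠ 1 := by decide
    have h02 : (0 : ℕ) ≠ 2 := by decide
    have h12 : (1 : ℕ) ≠ 2 := by decide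
    have hsum : ∑ i ∈ range (2 + 1), characterLValueD p ψ S₀ (i + 1) /
        ∏ k ∈ (range (2 + 1)).erase i,
          (((((cyclotomicGenerator p : ℕ) : ℚ_[p])⁻¹) ^ i - 1) -
            ((((cyclotomicGenerator p : ℕ) : ℚ_[p])⁻¹) ^ k - 1)) =
        characterLValueD p ψ S₀ 1 /
          (((((cyclotomicGenerator p : ℕ) : ℚ_[p])⁻¹) - 1) * ((((cyclotomicGenerator p : ℕ) : ℚ_[p])⁻¹) ^ 2 - 1)) +
        characterLValueD p ψ S₀ 2 /
          (((((cyclotomicGenerator p : ℕ) : ℚ_[p])⁻¹) - 1) *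
            (((((cyclotomicGenerator p : ℕ) : ℚ_[p])⁻¹) - 1) - ((((cyclotomicGenerator p : ℕ) : ℚ_[p])⁻¹) ^ 2 - 1))) +
        characterLValueD p ψ S₀ 3 /
          (((((cyclotomicGenerator p : ℕ) : ℚ_[p])⁻¹) ^ 2 - 1) *
            (((((cyclotomicGenerator p : ℕ) : ℚ_[p])⁻¹) ^ 2 - 1) - ((((cyclotomicGenerator p : ℕ) : ℚ_[p])⁻¹) - 1))) := by
      rw [Finset.sum_range_succ, Finset.sum_range_succ, Finset.sum_range_one, show (2 + 1 : ℕ) = 3 from rfl,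
        range_three_erase_zero, range_three_erase_one, range_three_erase_two,
        Finset.prod_pair h12, Finset.prod_pair h02, Finset.prod_pair h01, pow_zero, pow_one]
      simp only [sub_self, zero_sub, sub_zero, neg_mul_neg]
    rw [hsum]
    exact h2

end Literature.NumberTheory.EllipticCurves.GreenbergVatsal2000

end
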